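import Summits.Ventures.PercRepro.C041TriDomExcessNonneg

/-!
# ROW C-041 — THE DELETION–CONTRACTION METHOD for ANY admissible three-point functional
(p6, gen 41; P6-TWOEXIT-LEAN.md §53 ADDENDUM 1)

The proof of THEOREM (THE EXCESS IS NON-NEGATIVE) (`C041TriDomExcessRec`, `C041TriDomExcessNonneg`) used only two
properties of the symmetrised excess functional `Fsym`: it vanishes on the diagonal, and THE KEY LEMMA's inequality
`F s t + F s′ t′ ≤ F s′ t + F s t′` along one coarsening in each colour.  Here the same recursion is run for an ARBITRARY
functional `F : P3 → P3 → ℤ` with these two properties (`DCAdmissible F`): `sumF_nonneg` — `0 ≤ Σ_ω F (rsig st ω) (bsig st ω)`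
for every status — so every admissible `F` is a theorem about the status-type counts of every finite two-exit host
(`sum_styp_nonneg_of_admissible`, `sum_styp_nonneg_of_symF_admissible`: in terms of the tree's `styp`).  At three marks the cone of admissible functionals is
generated by the excess functional, the three FKG–complementation functionals and positivity (ADDENDUM 1, double
description); the three FKG–complementation inequalities `N_RRj + N_RRa ≥ N_RB` (`tcount_RB_le_RRj_add_RRa`) and its
two images under the rotation of the marks are derived here from the method alone — without Harris's inequality.
-/

namespace PercRepro

namespace ZoneZ

namespace MultiExit

open ZoneData Pendant Finset TwoExit TreeClosure RelaxedTriangle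

variable {V₁ E₁ U₁ U₂ : Type} (Z₁ : ZoneData V₁ E₁ U₁ U₂) (u u' a₁ : V₁)

/-! ## Admissible functionals -/

/-- A three-point functional admissible for the deletion–contraction method: zero on the diagonal of transitive patterns,
and THE KEY LEMMA's inequality along one coarsening in each colour. -/
structure DCAdmissible (F : P3 → P3 → ℤ) : Prop where
  /-- the diagonal vanishes -/
  diag : ∀ s, Trans3 s → F s s = 0
  /-- the second mixed difference along one coarsening in each colour has the right sign -/
  key : ∀ s s' t t', Trans3 s ∧ Trans3 s' ∧ Trans3 t ∧ Trans3 t' ∧ Le3 s s' ∧ Le3 t t' →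
    F s t + F s' t' ≤ F s' t + F s t'

/-- The symmetrised excess functional is admissible. -/
theorem dcAdmissible_Fsym : DCAdmissible Fsym :=
  ⟨fun s _ => Fsym_self s, key_lemma⟩

variable [DecidableEq E₁]

/-- The pointwise gap of the recursion for `F`. -/
noncomputable def gapF (F : P3 → P3 → ℤ) (st : E₁ → EStat) (f : E₁) (ω : E₁ → Bool) : ℤ :=
  F (rsig Z₁ u u' a₁ (Function.update st f .double) ω) (bsig Z₁ u u' a₁ (Function.update st f .absent) ω)
    + F (rsig Z₁ u u' a₁ (Function.update st f .absent) ω) (bsig Z₁ u u' a₁ (Function.update st f .double) ω)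
    - F (rsig Z₁ u u' a₁ (Function.update st f .absent) ω) (bsig Z₁ u u' a₁ (Function.update st f .absent) ω)
    - F (rsig Z₁ u u' a₁ (Function.update st f .double) ω) (bsig Z₁ u u' a₁ (Function.update st f .double) ω)

/-- The gap of an admissible functional is non-negative. -/
theorem gapF_nonneg {F : P3 → P3 → ℤ} (hF : DCAdmissible F) (st : E₁ → EStat) (f : E₁) (ω : E₁ → Bool) :
    0 ≤ gapF Z₁ u u' a₁ F st f ω := by
  have := hF.key _ _ _ _ ⟨trans3_rsig Z₁ u u' a₁ (Function.update st f .absent) ω,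
    trans3_rsig Z₁ u u' a₁ (Function.update st f .double) ω,
    trans3_bsig Z₁ u u' a₁ (Function.update st f .absent) ω,
    trans3_bsig Z₁ u u' a₁ (Function.update st f .double) ω,
    le3_rsig Z₁ u u' a₁ st f ω, le3_bsig Z₁ u u' a₁ st f ω⟩
  unfold gapF
  linarith

/-- Colouring `f` red or blue: the two summands of the recursion, for `F`. -/
theorem summandF_add_flip (F : P3 → P3 → ℤ) (st : E₁ → EStat) (f : E₁) (hf : st f = .free) (ω : E₁ → Bool) :
    F (rsig Z₁ u u' a₁ st ω) (bsig Z₁ u u' a₁ st ω)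
        + F (rsig Z₁ u u' a₁ st (flipC f ω)) (bsig Z₁ u u' a₁ st (flipC f ω)) =
      F (rsig Z₁ u u' a₁ (Function.update st f .double) ω) (bsig Z₁ u u' a₁ (Function.update st f .absent) ω)
        + F (rsig Z₁ u u' a₁ (Function.update st f .absent) ω) (bsig Z₁ u u' a₁ (Function.update st f .double) ω) := by
  have hd : EStat.double ≠ EStat.free := by decide
  have ha : EStat.absent ≠ EStat.free := by decide
  by_cases hω : ω f = true
  · have hω' : flipC f ω f = false := by simp [flipC_apply_self, hω]
    rw [rsig_of_true Z₁ u u' a₁ hf hω, bsig_of_true Z₁ u u' a₁ hf hω, rsig_of_false Z₁ u u' a₁ hf hω',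
      bsig_of_false Z₁ u u' a₁ hf hω']
    unfold flipC
    rw [rsig_update_nonfree Z₁ u u' a₁ st f ha, bsig_update_nonfree Z₁ u u' a₁ st f hd]
  · have hω0 : ω f = false := by simpa using hω
    have hω' : flipC f ω f = true := by simp [flipC_apply_self, hω0]
    rw [rsig_of_false Z₁ u u' a₁ hf hω0, bsig_of_false Z₁ u u' a₁ hf hω0, rsig_of_true Z₁ u u' a₁ hf hω',
      bsig_of_true Z₁ u u' a₁ hf hω']
    unfold flipC
    rw [rsig_update_nonfree Z₁ u u' a₁ st f hd, bsig_update_nonfree Z₁ u u' a₁ st f ha]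
    exact add_comm _ _

variable [Fintype E₁]

open Classical in
/-- The sum of `F` over all colourings of a status. -/
noncomputable def sumF (F : P3 → P3 → ℤ) (st : E₁ → EStat) : ℤ :=
  ∑ ω : E₁ → Bool, F (rsig Z₁ u u' a₁ st ω) (bsig Z₁ u u' a₁ st ω)

/-- **THE RECURSION** for `F`. -/
theorem sumF_rec (F : P3 → P3 → ℤ) (st : E₁ → EStat) (f : E₁) (hf : st f = .free) :
    2 * sumF Z₁ u u' a₁ F st = sumF Z₁ u u' a₁ F (Function.update st f .absent)
      + sumF Z₁ u u' a₁ F (Function.update st f .double) + ∑ ω : E₁ → Bool, gapF Z₁ u u' a₁ F st f ω := by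
  have hflip : ∑ ω : E₁ → Bool, F (rsig Z₁ u u' a₁ st ω) (bsig Z₁ u u' a₁ st ω) =
      ∑ ω : E₁ → Bool, F (rsig Z₁ u u' a₁ st (flipC f ω)) (bsig Z₁ u u' a₁ st (flipC f ω)) :=
    (Equiv.sum_comp (flipPerm f) (fun ω => F (rsig Z₁ u u' a₁ st ω) (bsig Z₁ u u' a₁ st ω))).symm
  have h2 : 2 * sumF Z₁ u u' a₁ F st = ∑ ω : E₁ → Bool,
      (F (rsig Z₁ u u' a₁ st ω) (bsig Z₁ u u' a₁ st ω)
        + F (rsig Z₁ u u' a₁ st (flipC f ω)) (bsig Z₁ u u' a₁ st (flipC f ω))) := by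
    rw [Finset.sum_add_distrib, ← hflip, sumF]; ring
  rw [h2, sumF, sumF, ← Finset.sum_add_distrib, ← Finset.sum_add_distrib]
  refine Finset.sum_congr rfl fun ω _ => ?_
  rw [summandF_add_flip Z₁ u u' a₁ F st f hf ω]
  unfold gapF
  ring

/-- Without free edges the sum of an admissible functional vanishes. -/
theorem sumF_of_nofree {F : P3 → P3 → ℤ} (hF : DCAdmissible F) (st : E₁ → EStat) (hst : ∀ e, st e ≠ .free) :
    sumF Z₁ u u' a₁ F st = 0 := by
  unfold sumF
  refine Finset.sum_eq_zero fun ω _ => ?_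
  rw [rsig_eq_bsig_of_nofree Z₁ u u' a₁ st hst ω]
  exact hF.diag _ (trans3_bsig Z₁ u u' a₁ st ω)

/-- **THE METHOD**: the sum of an admissible functional over the colourings of any status is non-negative. -/
theorem sumF_nonneg {F : P3 → P3 → ℤ} (hF : DCAdmissible F) (st : E₁ → EStat) : 0 ≤ sumF Z₁ u u' a₁ F st := by
  suffices h : ∀ n : ℕ, ∀ st : E₁ → EStat, nfree st = n → 0 ≤ sumF Z₁ u u' a₁ F st from h _ st rfl
  intro n
  induction n with
  | zero =>
    intro st hst
    have hno : ∀ e, st e ≠ .free := by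
      intro e he
      have : e ∈ (univ.filter fun e => st e = .free) := by simp [he]
      rw [Finset.card_eq_zero.mp hst] at this
      simp at this
    rw [sumF_of_nofree Z₁ u u' a₁ hF st hno]
  | succ n ih =>
    intro st hst
    have hne : (univ.filter fun e => st e = .free).Nonempty := by
      rw [← Finset.card_pos]; unfold nfree at hst; omega
    obtain ⟨f, hf⟩ := hne
    have hf' : st f = .free := (Finset.mem_filter.mp hf).2
    have ha := ih (Function.update st f .absent) (by
      have := nfree_update hf' (s := .absent) (by decide); omega)
    have hd := ih (Function.update st f .double) (by
      have := nfree_update hf' (s := .double) (by decide); omega)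
    have hg : 0 ≤ ∑ ω : E₁ → Bool, gapF Z₁ u u' a₁ F st f ω :=
      Finset.sum_nonneg fun ω _ => gapF_nonneg Z₁ u u' a₁ hF st f ω
    have := sumF_rec Z₁ u u' a₁ F st f hf'
    linarith

open Classical in
/-- **THE METHOD ON THE STATUS TYPES**: for an admissible `F`, the sum of `F` at the red and blue coordinates of the
status type is non-negative. -/
theorem sum_styp_nonneg_of_admissible {F : P3 → P3 → ℤ} (hF : DCAdmissible F) :
    0 ≤ ∑ ω : E₁ → Bool, F ((styp Z₁ u u' a₁ ω).2.1, (styp Z₁ u u' a₁ ω).2.2.2.1, (styp Z₁ u u' a₁ ω).2.2.2.2.2)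
      ((styp Z₁ u u' a₁ ω).1, (styp Z₁ u u' a₁ ω).2.2.1, (styp Z₁ u u' a₁ ω).2.2.2.2.1) := by
  have h := sumF_nonneg Z₁ u u' a₁ hF (fun _ => EStat.free)
  unfold sumF at h
  simpa only [rsig_free, bsig_free] using h

/-! ## Symmetrisation and the FKG–complementation inequalities from the method alone -/

/-- The symmetrisation of a functional. -/
def symF (F : P3 → P3 → ℤ) (s t : P3) : ℤ := F s t + F t s

open Classical in
/-- The complementation exchanges the two arguments of any functional: the swapped sum is the same sum (all edges free). -/
theorem sum_swap_free (F : P3 → P3 → ℤ) :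
    ∑ ω : E₁ → Bool, F (bsig Z₁ u u' a₁ (fun _ => EStat.free) ω) (rsig Z₁ u u' a₁ (fun _ => EStat.free) ω) =
      ∑ ω : E₁ → Bool, F (rsig Z₁ u u' a₁ (fun _ => EStat.free) ω) (bsig Z₁ u u' a₁ (fun _ => EStat.free) ω) := by
  have hinv : Function.Involutive (ZoneData.cpl (E := E₁)) := ZoneData.cpl_cpl
  conv_rhs => rw [← Equiv.sum_comp hinv.toPerm
    (fun ω => F (rsig Z₁ u u' a₁ (fun _ => EStat.free) ω) (bsig Z₁ u u' a₁ (fun _ => EStat.free) ω))]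
  refine Finset.sum_congr rfl fun ω _ => ?_
  simp only [Function.Involutive.coe_toPerm]
  rw [rsig_free Z₁ u u' a₁, bsig_free Z₁ u u' a₁, rsig_free Z₁ u u' a₁, bsig_free Z₁ u u' a₁, styp_cpl]
  rfl

open Classical in
/-- **THE METHOD ON THE STATUS TYPES**: if the symmetrisation of `F` is admissible, the sum of `F` at the red and blue
coordinates of the status type is non-negative. -/
theorem sum_styp_nonneg_of_symF_admissible {F : P3 → P3 → ℤ} (hF : DCAdmissible (symF F)) :
    0 ≤ ∑ ω : E₁ → Bool, F ((styp Z₁ u u' a₁ ω).2.1, (styp Z₁ u u' a₁ ω).2.2.2.1, (styp Z₁ u u' a₁ ω).2.2.2.2.2)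
      ((styp Z₁ u u' a₁ ω).1, (styp Z₁ u u' a₁ ω).2.2.1, (styp Z₁ u u' a₁ ω).2.2.2.2.1) := by
  have h := sumF_nonneg Z₁ u u' a₁ hF (fun _ => EStat.free)
  unfold sumF at h
  simp only [symF, Finset.sum_add_distrib, sum_swap_free Z₁ u u' a₁ F] at h
  have h2 : 0 ≤ ∑ ω : E₁ → Bool, F (rsig Z₁ u u' a₁ (fun _ => EStat.free) ω) (bsig Z₁ u u' a₁ (fun _ => EStat.free) ω) := by
    linarith
  simpa only [rsig_free, bsig_free] using h2

/-- The functional of `N_RRj + N_RRa − N_RB`: `+1` on `(⊤, uu′|a)` and `(⊤, ⊥)`, `−1` on `(au|u′ ; au′|u)`. -/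
def Ffkg (s t : P3) : ℤ :=
  (if s = (true, true, true) ∧ t = (false, false, true) then 1 else 0)
    + (if s = (true, true, true) ∧ t = (false, false, false) then 1 else 0)
    - (if s = (true, false, false) ∧ t = (false, true, false) then 1 else 0)

/-- The symmetrised FKG–complementation functional is admissible. -/
theorem dcAdmissible_symF_Ffkg : DCAdmissible (symF Ffkg) := by
  refine ⟨?_, ?_⟩
  · decide
  · decide

/-- The FKG–complementation functional at a status type. -/
def FfkgT (t : Typ) : ℤ :=
  (if t = (false, true, false, true, true, true) then 1 else 0)
    + (if t = (false, true, false, true, false, true) then 1 else 0)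
    - (if t = (false, true, true, false, false, false) then 1 else 0)

/-- `FfkgT` is `Ffkg` at the red and blue coordinates of the type. -/
theorem FfkgT_eq (t : Typ) :
    FfkgT t = Ffkg (t.2.1, t.2.2.2.1, t.2.2.2.2.2) (t.1, t.2.2.1, t.2.2.2.2.1) := by
  revert t; decide

open Classical in
/-- **`N_RB ≤ N_RRj + N_RRa`** (§52 ADDENDUM 1 (e): Harris–FKG + complementation) — here from the deletion–contraction
method alone. -/
theorem tcount_RB_le_RRj_add_RRa :
    tcount Z₁ u u' a₁ (false, true, true, false, false, false) ≤
      tcount Z₁ u u' a₁ (false, true, false, true, true, true) + tcount Z₁ u u' a₁ (false, true, false, true, false, true) := by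
  have h := sum_styp_nonneg_of_symF_admissible Z₁ u u' a₁ dcAdmissible_symF_Ffkg
  have h2 : ∑ ω : E₁ → Bool, Ffkg ((styp Z₁ u u' a₁ ω).2.1, (styp Z₁ u u' a₁ ω).2.2.2.1, (styp Z₁ u u' a₁ ω).2.2.2.2.2)
      ((styp Z₁ u u' a₁ ω).1, (styp Z₁ u u' a₁ ω).2.2.1, (styp Z₁ u u' a₁ ω).2.2.2.2.1) =
      ∑ ω : E₁ → Bool, FfkgT (styp Z₁ u u' a₁ ω) :=
    Finset.sum_congr rfl fun ω _ => (FfkgT_eq _).symm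
  rw [h2] at h
  have h3 : ∑ ω : E₁ → Bool, FfkgT (styp Z₁ u u' a₁ ω) =
      (tcount Z₁ u u' a₁ (false, true, false, true, true, true) : ℤ)
        + tcount Z₁ u u' a₁ (false, true, false, true, false, true)
        - tcount Z₁ u u' a₁ (false, true, true, false, false, false) := by
    simp only [tcount_eq_sum, Nat.cast_sum, Nat.cast_ite, Nat.cast_one, Nat.cast_zero, ← Finset.sum_add_distrib,
      ← Finset.sum_sub_distrib]
    rfl
  rw [h3] at h
  omega

/-- The apex-`u` FKG–complementation functional: `+1` on `(⊤, au′|u)` and `(⊤, ⊥)`, `−1` on `(au|u′ ; uu′|a)`. -/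
def Ffkg2 (s t : P3) : ℤ :=
  (if s = (true, true, true) ∧ t = (false, true, false) then 1 else 0)
    + (if s = (true, true, true) ∧ t = (false, false, false) then 1 else 0)
    - (if s = (true, false, false) ∧ t = (false, false, true) then 1 else 0)

/-- The symmetrised apex-`u` functional is admissible. -/
theorem dcAdmissible_symF_Ffkg2 : DCAdmissible (symF Ffkg2) := by
  refine ⟨?_, ?_⟩
  · decide
  · decide

/-- The apex-`u` functional at a status type: `N_RX + N_RRa − N_RWj`. -/
def FfkgT2 (t : Typ) : ℤ :=
  (if t = (false, true, true, true, false, true) then 1 else 0)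
    + (if t = (false, true, false, true, false, true) then 1 else 0)
    - (if t = (false, true, false, false, true, false) then 1 else 0)

/-- `FfkgT2` is `Ffkg2` at the red and blue coordinates of the type. -/
theorem FfkgT2_eq (t : Typ) :
    FfkgT2 t = Ffkg2 (t.2.1, t.2.2.2.1, t.2.2.2.2.2) (t.1, t.2.2.1, t.2.2.2.2.1) := by
  revert t; decide

open Classical in
/-- **`N_RWj ≤ N_RX + N_RRa`** — the apex-`u` FKG–complementation inequality from the method alone. -/
theorem tcount_RWj_le_RX_add_RRa :
    tcount Z₁ u u' a₁ (false, true, false, false, true, false) ≤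
      tcount Z₁ u u' a₁ (false, true, true, true, false, true) + tcount Z₁ u u' a₁ (false, true, false, true, false, true) := by
  have h := sum_styp_nonneg_of_symF_admissible Z₁ u u' a₁ dcAdmissible_symF_Ffkg2
  have h2 : ∑ ω : E₁ → Bool, Ffkg2 ((styp Z₁ u u' a₁ ω).2.1, (styp Z₁ u u' a₁ ω).2.2.2.1, (styp Z₁ u u' a₁ ω).2.2.2.2.2)
      ((styp Z₁ u u' a₁ ω).1, (styp Z₁ u u' a₁ ω).2.2.1, (styp Z₁ u u' a₁ ω).2.2.2.2.1) =
      ∑ ω : E₁ → Bool, FfkgT2 (styp Z₁ u u' a₁ ω) :=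
    Finset.sum_congr rfl fun ω _ => (FfkgT2_eq _).symm
  rw [h2] at h
  have h3 : ∑ ω : E₁ → Bool, FfkgT2 (styp Z₁ u u' a₁ ω) =
      (tcount Z₁ u u' a₁ (false, true, true, true, false, true) : ℤ)
        + tcount Z₁ u u' a₁ (false, true, false, true, false, true)
        - tcount Z₁ u u' a₁ (false, true, false, false, true, false) := by
    simp only [tcount_eq_sum, Nat.cast_sum, Nat.cast_ite, Nat.cast_one, Nat.cast_zero, ← Finset.sum_add_distrib,
      ← Finset.sum_sub_distrib]
    rfl
  rw [h3] at h
  omega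

/-- The apex-`u′` FKG–complementation functional: `+1` on `(⊤, au|u′)` and `(⊤, ⊥)`, `−1` on `(au′|u ; uu′|a)`. -/
def Ffkg3 (s t : P3) : ℤ :=
  (if s = (true, true, true) ∧ t = (true, false, false) then 1 else 0)
    + (if s = (true, true, true) ∧ t = (false, false, false) then 1 else 0)
    - (if s = (false, true, false) ∧ t = (false, false, true) then 1 else 0)

/-- The symmetrised apex-`u′` functional is admissible. -/
theorem dcAdmissible_symF_Ffkg3 : DCAdmissible (symF Ffkg3) := by
  refine ⟨?_, ?_⟩
  · decide
  · decide

/-- The apex-`u′` functional at a status type: `N_XR + N_RRa − N_WRj`. -/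
def FfkgT3 (t : Typ) : ℤ :=
  (if t = (true, true, false, true, false, true) then 1 else 0)
    + (if t = (false, true, false, true, false, true) then 1 else 0)
    - (if t = (false, false, false, true, true, false) then 1 else 0)

/-- `FfkgT3` is `Ffkg3` at the red and blue coordinates of the type. -/
theorem FfkgT3_eq (t : Typ) :
    FfkgT3 t = Ffkg3 (t.2.1, t.2.2.2.1, t.2.2.2.2.2) (t.1, t.2.2.1, t.2.2.2.2.1) := by
  revert t; decide

open Classical in
/-- **`N_WRj ≤ N_XR + N_RRa`** — the apex-`u′` FKG–complementation inequality from the method alone. -/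
theorem tcount_WRj_le_XR_add_RRa :
    tcount Z₁ u u' a₁ (false, false, false, true, true, false) ≤
      tcount Z₁ u u' a₁ (true, true, false, true, false, true) + tcount Z₁ u u' a₁ (false, true, false, true, false, true) := by
  have h := sum_styp_nonneg_of_symF_admissible Z₁ u u' a₁ dcAdmissible_symF_Ffkg3
  have h2 : ∑ ω : E₁ → Bool, Ffkg3 ((styp Z₁ u u' a₁ ω).2.1, (styp Z₁ u u' a₁ ω).2.2.2.1, (styp Z₁ u u' a₁ ω).2.2.2.2.2)
      ((styp Z₁ u u' a₁ ω).1, (styp Z₁ u u' a₁ ω).2.2.1, (styp Z₁ u u' a₁ ω).2.2.2.2.1) =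
      ∑ ω : E₁ → Bool, FfkgT3 (styp Z₁ u u' a₁ ω) :=
    Finset.sum_congr rfl fun ω _ => (FfkgT3_eq _).symm
  rw [h2] at h
  have h3 : ∑ ω : E₁ → Bool, FfkgT3 (styp Z₁ u u' a₁ ω) =
      (tcount Z₁ u u' a₁ (true, true, false, true, false, true) : ℤ)
        + tcount Z₁ u u' a₁ (false, true, false, true, false, true)
        - tcount Z₁ u u' a₁ (false, false, false, true, true, false) := by
    simp only [tcount_eq_sum, Nat.cast_sum, Nat.cast_ite, Nat.cast_one, Nat.cast_zero, ← Finset.sum_add_distrib,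
      ← Finset.sum_sub_distrib]
    rfl
  rw [h3] at h
  omega

end MultiExit

end ZoneZ

end PercRepro
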